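import Summits.BirchSwinnertonDyer.Rank1Residual.Additive.RamifiedOrdinaryLineKummerKernel
import HarnessLib

/-!
# The quotient character of the ramified ordinary line on a (G-ord) row has EXACT order
# `e = semistabilityIndex W p` (`p ≥ 5`, `e ∈ {3, 4, 6}`), with a FREELY acting generator — row level,
# model-free (cell `b2b-bsdres`, team n1011, seat p07 (gen 8); row T-ROL-ORD FILE F3b)

HONEST FRAMING (cell `b2b-bsdres`, run/shared/lean/b2b/bsd-rank1-residual/, verbatim in every
file): the goal of the cell is to DELETE the COMBINATION-SHAPED residual classes of the
Birch–Swinnerton-Dyer formula for ALL analytic-rank `≤ 1` elliptic curves over `ℚ` — "full BSD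
formula for every rank `≤ 1` curve in class `C`" assembled STRICTLY from published theorems — so
that the rank-`≤ 1` remainder becomes exactly the CONSTRUCTION-SHAPED classes, which are TYPED
(missing-input `Prop`s), NOT attempted. This is not "finishing BSD". Team n1011 (N10/N11): research
route on the CONSTRUCTION-SHAPED classes X3♯(G-ord)/X4♯(G-ord); prove what is provable now; no
claim beyond stated classes; census output = EVIDENCE, never a Literature fact; RESIDUAL-MAP marks
UNCHANGED; nothing is booked by this file. TOOL theorems only: NO definition, NO named fact, NO
conjecture node; 0 hypotheses beyond `TypeGOrd`, `Addv`, `5 ≤ p`, `e ≠ 2`, `p ∈ v` and the line.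

## What and why

cc-typer-2's TRANSPORT-TEMPLATE v2.1 types, for the swap-locus matching S4/S4b, ONE missing input:
the EXACT order `e` of the quotient character `ϑ : I_v → Aut(E[p^∞]/C)` of the ramified ordinary line
on a (G-ord) row ("`∃ σ ∈ I_v, ∃ m, (res σ)^{e/q} • m − m ∉ L.plus` for each prime `q ∣ e`").
From FILE F3a (the kernel of `ϑ` on the Kummer–Deuring model is the fixing group of `θ = p^{1/e}`)
and cc-typer-2's uniqueness of the line (p280951):

* §2 **`IsRamifiedOrdinaryLine.forall_smul_sub_mem_plus_iff_smul_eq`** — for EVERY ramified ordinary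
  line `L` on a (G-ord) row (`p ≥ 5`, `e ≠ 2`), every `θ` with `θ^e = p` and every `σ ∈ I_v`:
  `(∀ m, σm − m ∈ C) ↔ σθ = θ`; **`….smul_eq_of_smul_sub_mem_plus`** — freeness.
* §3 **`IsRamifiedOrdinaryLine.exists_inertia_forall_pow_smul_sub_not_mem`** — THE EXACT ORDER:
  some `σ ∈ I_v` has `σ^d m − m ∉ C` for all `0 < d < e` and all `m ∉ C` (Kummer surjectivity +
  inertia fixes `μ_e`); `…_of_not_dvd` — the same for every `d` with `e ∤ d` (with B's `σ^e = 1`);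
  the prime-divisor form `…exists_inertia_forall_prime_pow_div_smul_sub_not_mem` = TT v2.1's
  literal ask; and the NEGATIVE HALF-POWER **`….exists_inertia_pow_half_smul_sub_not_mem`** — on
  rows with `e` even, `e ≠ 2`, `(p−1)/e` odd (the (5;4) and (7;6) rows) the QUOTIENT half-power
  FAILS: `σ^{(p−1)/2}` moves every vector of `E[p^∞]/C` ("NOT quotient-even" — the half of
  cc-typer-2's parity dictionary that only exactness gives; the positive half "line-even" is the
  (P-e46-odd) producer, T-ROL-ORD's F4 lane = p16's `lineHalfPow_of_typeGOrd_of_even`).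
* §4 class forms `ClassX4Gord./ClassX3Gord.…`.

Serre 1972 §5.6 (`p ≥ 5`: `Φ_p` is cyclic of order `e = 12 / gcd(12, v_p(Δ))`) / Serre–Tate 1968 §2
Cor. 2 (the inertia group of the field of good reduction acts faithfully on the special fibre).
NOT claimed: `e = 2` (cc-typer-2's (P-def2-odd)); `p ≤ 3`; the positive half-power (P-e46-odd)
(p16's files under this row); any identification of `ϑ` with a power of `ω`.

References: J.-P. Serre, Invent. Math. 15 (1972) §1.3, §5.6 [Serre1972]; J.-P. Serre, J. Tate,
Ann. of Math. 88 (1968) §2 Thm. 2, Cor. 2 [SerreTate1968]; R. Greenberg, V. Vatsal, Invent. Math.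
142 (2000) §2 p. 26 [GreenbergVatsal2000]; M. Emerton, R. Pollack, T. Weston, Invent. Math. 163
(2006) §3.1 [EmertonPollackWeston2006]; cells/n1011/skel/T-ROL-ORD.md;
class-closure/N10/TRANSPORT-TEMPLATE.md v2.1.
-/

set_option autoImplicit false

noncomputable section

open scoped Classical NNReal NumberField Valued

open WeierstrassCurve

universe u

/-! ## §2 Row level (model-free by uniqueness): the kernel of the quotient character of EVERY
ramified ordinary line, and its freeness -/

namespace Literature.NumberTheory.EllipticCurves.EmertonPollackWeston2006.IsRamifiedOrdinaryLine

open NumberField IsDedekindDomain Field IsDedekindDomain.HeightOneSpectrum WeierstrassCurve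
  Literature.NumberTheory.GaloisRepresentations Literature.NumberTheory.EllipticCurves
  Literature.NumberTheory.EllipticCurves.GreenbergSelmer
  Literature.NumberTheory.EllipticCurves.Rank1Residual
  Summit.BirchSwinnertonDyer.Rank1Residual.Additive
  Summit.BirchSwinnertonDyer.Rank1Residual.Additive.GoodModelLine

variable {W : WeierstrassCurve ℚ} [W.IsElliptic] [W.IsGloballyMinimal] {p : ℕ} [hp : Fact p.Prime]
  {v : HeightOneSpectrum (𝓞 ℚ)}

/-- **THE KERNEL OF THE QUOTIENT CHARACTER IS THE FIXING GROUP OF `p^{1/e}`** (`p ≥ 5`,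
`e = semistabilityIndex W p ≠ 2`). For `E/ℚ` globally minimal, additive at `p` of type (G)-ordinary,
ANY ramified ordinary line `L` of `E` at `v ∋ p`, any `θ ∈ K̄_v` with `θ^e = p` and any local
inertia element `σ`: `σ m − m ∈ C` for all `m ∈ E[p^∞]` iff `σ θ = θ`. (By uniqueness the line is
the Kummer–Deuring line of §1.) So `ϑ : I_v → Aut(E[p^∞]/C)` factors through
`Gal(ℚ_v^{nr}(p^{1/e})/ℚ_v^{nr}) ≃ μ_e` INJECTIVELY — Serre–Tate faithfulness on the étale quotient.
[cite: SerreTate1968, §2 Thm. 2 and Cor. 2] [cite: Serre1972, §5.6 (p. 312)]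
[cite: GreenbergVatsal2000, §2 p. 26] -/
theorem forall_smul_sub_mem_plus_iff_smul_eq (hp5 : 5 ≤ p) (hG : TypeGOrd W p) (hadd : Addv W p)
    (he : semistabilityIndex W p ≠ 2) (hpv : ((p : ℕ) : 𝓞 ℚ) ∈ v.asIdeal)
    {L : LocalDatum ℚ (W.geomPrimaryTorsion p) v} (hL : IsRamifiedOrdinaryLine W p L)
    {θ : AlgebraicClosure (v.adicCompletion ℚ)}
    (hθ : θ ^ semistabilityIndex W p = ((p : ℕ) : AlgebraicClosure (v.adicCompletion ℚ)))
    {σ : absoluteGaloisGroup (v.adicCompletion ℚ)} (hσ : σ ∈ absInertia (v.adicCompletion ℚ)) :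
    (∀ m : W.geomPrimaryTorsion p, absGaloisRestrict ℚ (v.adicCompletion ℚ) σ • m - m ∈ L.plus) ↔
      σ • θ = θ := by
  obtain ⟨L', hL', hiff, -⟩ :=
    exists_isRamifiedOrdinaryLine_and_forall_iff_smul_eq_of_typeGOrd W p hp5 hG hadd he hpv hθ
  rw [hL.eq_of_isRamifiedOrdinaryLine hL' hpv]
  exact hiff σ hσ

/-- **FREENESS**: an inertial `τ` fixing ONE non-zero vector of `E[p^∞]/C` (`τ m − m ∈ C`,
`m ∉ C`) fixes `p^{1/e}` — hence (previous theorem) acts trivially on `E[p^∞]/C`; every inertial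
element acts on `E[p^∞]/C` trivially or freely. [cite: SerreTate1968, §2 Thm. 2 (mechanism of proof)]
[cite: SilvermanAEC2009, III.10] -/
theorem smul_eq_of_smul_sub_mem_plus (hp5 : 5 ≤ p) (hG : TypeGOrd W p) (hadd : Addv W p)
    (he : semistabilityIndex W p ≠ 2) (hpv : ((p : ℕ) : 𝓞 ℚ) ∈ v.asIdeal)
    {L : LocalDatum ℚ (W.geomPrimaryTorsion p) v} (hL : IsRamifiedOrdinaryLine W p L)
    {θ : AlgebraicClosure (v.adicCompletion ℚ)}
    (hθ : θ ^ semistabilityIndex W p = ((p : ℕ) : AlgebraicClosure (v.adicCompletion ℚ)))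
    {τ : absoluteGaloisGroup (v.adicCompletion ℚ)} (hτ : τ ∈ absInertia (v.adicCompletion ℚ))
    {m : W.geomPrimaryTorsion p} (hm : m ∉ L.plus)
    (hτm : absGaloisRestrict ℚ (v.adicCompletion ℚ) τ • m - m ∈ L.plus) : τ • θ = θ := by
  obtain ⟨L', hL', -, hfree⟩ :=
    exists_isRamifiedOrdinaryLine_and_forall_iff_smul_eq_of_typeGOrd W p hp5 hG hadd he hpv hθ
  have hLL' := hL.eq_of_isRamifiedOrdinaryLine hL' hpv
  subst hLL'
  exact hfree τ hτ m hm hτm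

/-! ## §3 THE EXACT ORDER `e` -/

/-- **THE QUOTIENT CHARACTER OF THE RAMIFIED ORDINARY LINE HAS EXACT ORDER `e`, AND A GENERATOR
ACTS FREELY** (`p ≥ 5`, `e = semistabilityIndex W p ∈ {3, 4, 6}`). For `E/ℚ` globally minimal,
additive at `p` of type (G)-ordinary with `e ≠ 2`, and ANY ramified ordinary line `L` at `v ∋ p`:
some local inertia element `σ` satisfies `σ^d m − m ∉ C` for EVERY `0 < d < e` and EVERY
`m ∈ E[p^∞] ∖ C`. With T-ROL-EXP B (`σ^e` trivial) the order of `ϑ(σ)` is exactly `e`. Proof: take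
`θ = p^{1/e}` and `σ ∈ I_v` with `σθ = ζθ`, `ζ` a PRIMITIVE `e`-th root of unity (Kummer
surjectivity); inertia fixes `ζ` (§0), so `σ^d θ = ζ^d θ ≠ θ`; by freeness `σ^d` fixes no non-zero
vector. Serre 1972 §5.6: for `p ≥ 5` the image `Φ_p` of inertia is cyclic of order
`e = 12/gcd(12, v_p(Δ))`. [cite: Serre1972, §5.6 (p. 312) and §1.3]
[cite: SerreTate1968, §2 Thm. 2 and Cor. 2] [cite: GreenbergVatsal2000, §2 p. 26] -/
theorem exists_inertia_forall_pow_smul_sub_not_mem (hp5 : 5 ≤ p) (hG : TypeGOrd W p)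
    (hadd : Addv W p) (he : semistabilityIndex W p ≠ 2) (hpv : ((p : ℕ) : 𝓞 ℚ) ∈ v.asIdeal)
    {L : LocalDatum ℚ (W.geomPrimaryTorsion p) v} (hL : IsRamifiedOrdinaryLine W p L) :
    ∃ σ ∈ absInertia (v.adicCompletion ℚ), ∀ d : ℕ, 0 < d → d < semistabilityIndex W p →
      ∀ m : W.geomPrimaryTorsion p, m ∉ L.plus →
        (absGaloisRestrict ℚ (v.adicCompletion ℚ) σ) ^ d • m - m ∉ L.plus := by
  haveI : CharZero (AlgebraicClosure (v.adicCompletion ℚ)) :=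
    charZero_of_injective_algebraMap (algebraMap ℚ _).injective
  have he0 : semistabilityIndex W p ≠ 0 := semistabilityIndex_ne_zero p W
  have hpe : ¬ p ∣ semistabilityIndex W p := not_dvd_semistabilityIndex p W hp5
  obtain ⟨θ, hθ⟩ := IsAlgClosed.exists_pow_nat_eq ((p : ℕ) : AlgebraicClosure (v.adicCompletion ℚ))
    (Nat.pos_of_ne_zero he0)
  obtain ⟨ζ, hζ, σ, hσ, hσθ⟩ := exists_mem_absInertia_smul_eq_primitiveRoot_mul W p hpv hθ
  have hθ0 : θ ≠ 0 := fun h ↦ by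
    rw [h, zero_pow he0] at hθ
    exact Nat.cast_ne_zero.mpr hp.out.ne_zero hθ.symm
  have hσζ : σ • ζ = ζ := smul_eq_self_of_pow_eq_one p hpv he0 hpe hζ.pow_eq_one hσ
  refine ⟨σ, hσ, fun d hd0 hde m hm hcontra ↦ ?_⟩
  have hτ : σ ^ d ∈ absInertia (v.adicCompletion ℚ) := Subgroup.pow_mem _ hσ d
  rw [← map_pow] at hcontra
  have hfix : (σ ^ d) • θ = θ := smul_eq_of_smul_sub_mem_plus hp5 hG hadd he hpv hL hθ hτ hm hcontra
  rw [pow_smul_eq_pow_mul hσθ hσζ d] at hfix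
  have hζd : ζ ^ d = 1 := by
    have h := mul_right_cancel₀ hθ0 (hfix.trans (one_mul θ).symm)
    exact h
  exact hζ.pow_ne_one_of_pos_of_lt hd0.ne' hde hζd

/-- **The prime-divisor form** (TT v2.1's literal ask "`∃ σ ∈ I_v, ∃ m, (res σ)^{e/q} • m − m ∉ L.plus`
for each prime `q ∣ e`", with ONE `σ` serving every `q`): for every prime `q ∣ e` the power
`σ^{e/q}` moves `E[p^∞]/C`. [cite: Serre1972, §5.6 (p. 312)] [cite: SerreTate1968, §2 Thm. 2 and Cor. 2] -/
theorem exists_inertia_forall_prime_pow_div_smul_sub_not_mem (hp5 : 5 ≤ p) (hG : TypeGOrd W p)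
    (hadd : Addv W p) (he : semistabilityIndex W p ≠ 2) (hpv : ((p : ℕ) : 𝓞 ℚ) ∈ v.asIdeal)
    {L : LocalDatum ℚ (W.geomPrimaryTorsion p) v} (hL : IsRamifiedOrdinaryLine W p L) :
    ∃ σ ∈ absInertia (v.adicCompletion ℚ), ∀ q : ℕ, q.Prime → q ∣ semistabilityIndex W p →
      ∃ m : W.geomPrimaryTorsion p,
        (absGaloisRestrict ℚ (v.adicCompletion ℚ) σ) ^ (semistabilityIndex W p / q) • m - m ∉ L.plus := by
  obtain ⟨σ, hσ, hfree⟩ := exists_inertia_forall_pow_smul_sub_not_mem hp5 hG hadd he hpv hL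
  have he0 : semistabilityIndex W p ≠ 0 := semistabilityIndex_ne_zero p W
  -- a vector outside the line
  obtain ⟨m, hm⟩ : ∃ m : W.geomPrimaryTorsion p, m ∉ L.plus := by
    by_contra h
    push Not at h
    exact hL.plus_ne_top (eq_top_iff.mpr fun m _ ↦ h m)
  refine ⟨σ, hσ, fun q hq hqe ↦ ⟨m, hfree _ ?_ ?_ m hm⟩⟩
  · exact Nat.div_pos (Nat.le_of_dvd (Nat.pos_of_ne_zero he0) hqe) hq.pos
  · exact Nat.div_lt_self (Nat.pos_of_ne_zero he0) hq.one_lt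

/-- Powers `σ^{e k}` act trivially on `E[p^∞]/C` (iterate T-ROL-EXP B's `σ^e`). [folklore] -/
theorem pow_mul_semistabilityIndex_smul_sub_mem (hp5 : 5 ≤ p) (hG : TypeGOrd W p) (hadd : Addv W p)
    (hpv : ((p : ℕ) : 𝓞 ℚ) ∈ v.asIdeal) {L : LocalDatum ℚ (W.geomPrimaryTorsion p) v}
    (hL : IsRamifiedOrdinaryLine W p L) {σ : absoluteGaloisGroup (v.adicCompletion ℚ)}
    (hσ : σ ∈ absInertia (v.adicCompletion ℚ)) (k : ℕ) (m : W.geomPrimaryTorsion p) :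
    (absGaloisRestrict ℚ (v.adicCompletion ℚ) σ) ^ (semistabilityIndex W p * k) • m - m ∈ L.plus := by
  induction k with
  | zero => rw [mul_zero, pow_zero, one_smul, sub_self]; exact zero_mem _
  | succ k ih =>
    have hstep := hL.pow_semistabilityIndex_smul_sub_mem hp5 hG hadd hpv σ hσ
      ((absGaloisRestrict ℚ (v.adicCompletion ℚ) σ) ^ (semistabilityIndex W p * k) • m)
    have : (absGaloisRestrict ℚ (v.adicCompletion ℚ) σ) ^ (semistabilityIndex W p * (k + 1)) • m - m =
        ((absGaloisRestrict ℚ (v.adicCompletion ℚ) σ) ^ semistabilityIndex W p •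
            ((absGaloisRestrict ℚ (v.adicCompletion ℚ) σ) ^ (semistabilityIndex W p * k) • m) -
          (absGaloisRestrict ℚ (v.adicCompletion ℚ) σ) ^ (semistabilityIndex W p * k) • m) +
        ((absGaloisRestrict ℚ (v.adicCompletion ℚ) σ) ^ (semistabilityIndex W p * k) • m - m) := by
      rw [Nat.mul_succ, add_comm, pow_add, mul_smul]; abel
    rw [this]
    exact add_mem hstep ih

/-- **Every power `σ^d` with `e ∤ d` acts FREELY on `E[p^∞]/C`** for the generator `σ` of the
exact-order theorem (reduce `d` modulo `e` with T-ROL-EXP B's `σ^e = 1` on `E[p^∞]/C`).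
[cite: Serre1972, §5.6 (p. 312)] [cite: SerreTate1968, §2 Thm. 2 and Cor. 2] -/
theorem exists_inertia_forall_pow_smul_sub_not_mem_of_not_dvd (hp5 : 5 ≤ p) (hG : TypeGOrd W p)
    (hadd : Addv W p) (he : semistabilityIndex W p ≠ 2) (hpv : ((p : ℕ) : 𝓞 ℚ) ∈ v.asIdeal)
    {L : LocalDatum ℚ (W.geomPrimaryTorsion p) v} (hL : IsRamifiedOrdinaryLine W p L) :
    ∃ σ ∈ absInertia (v.adicCompletion ℚ), ∀ d : ℕ, ¬ semistabilityIndex W p ∣ d →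
      ∀ m : W.geomPrimaryTorsion p, m ∉ L.plus →
        (absGaloisRestrict ℚ (v.adicCompletion ℚ) σ) ^ d • m - m ∉ L.plus := by
  obtain ⟨σ, hσ, hfree⟩ := exists_inertia_forall_pow_smul_sub_not_mem hp5 hG hadd he hpv hL
  have he0 : 0 < semistabilityIndex W p := Nat.pos_of_ne_zero (semistabilityIndex_ne_zero p W)
  refine ⟨σ, hσ, fun d hd m hm hcontra ↦ ?_⟩
  set g := absGaloisRestrict ℚ (v.adicCompletion ℚ) σ with hg
  set e := semistabilityIndex W p with hedef
  -- `d = e k + r`, `0 < r < e`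
  set k := d / e with hk
  set r := d % e with hr
  have hd' : d = e * k + r := (Nat.div_add_mod d e).symm
  have hr0 : 0 < r := Nat.pos_of_ne_zero fun h ↦ hd (Nat.dvd_of_mod_eq_zero h)
  have hre : r < e := Nat.mod_lt d he0
  -- `m' = σ^{ek} m ≡ m (mod C)`, `m' ∉ C`
  set m' := g ^ (e * k) • m with hm'
  have hm'm : m' - m ∈ L.plus := pow_mul_semistabilityIndex_smul_sub_mem hp5 hG hadd hpv hL hσ k m
  have hm'C : m' ∉ L.plus := fun h ↦ hm (by
    have := sub_mem h hm'm
    rwa [sub_sub_cancel] at this)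
  -- `σ^r m' − m' = (σ^d m − m) − (m' − m) ∈ C`, contradicting freeness of `σ^r`
  have hrm' : g ^ r • m' - m' ∈ L.plus := by
    have h1 : g ^ d • m = g ^ r • m' := by rw [hm', ← mul_smul, ← pow_add, add_comm, ← hd']
    have : g ^ r • m' - m' = (g ^ d • m - m) - (m' - m) := by rw [h1]; abel
    rw [this]
    exact sub_mem hcontra hm'm
  exact hfree r hr0 hre m' hm'C hrm'

/-- **"NOT QUOTIENT-EVEN": on a (G-ord) row with `e` even, `e ≠ 2` and `(p−1)/e` ODD (the (5;4) and
(7;6) rows: `p ≡ 5 (mod 8)` resp. `p ≡ 7 (mod 12)`), the quotient half-power FAILS** — some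
`σ ∈ I_v` has `σ^{(p−1)/2} m − m ∉ C` for EVERY `m ∉ C` (`e ∤ (p−1)/2 = (e/2)·(p−1)/e`). The half of
cc-typer-2's parity dictionary (TT v2.1, S4 `false_of_lineHalfPow_of_quotHalfPow`) that needs the
EXACT order; the positive half ("line-even", (P-e46-odd)) is the row's F4 lane.
[cite: Serre1972, §5.6 (p. 312)] [cite: EmertonPollackWeston2006, §3.1 (eq:ordes) (arXiv:math/0404484 p. 17)] -/
theorem exists_inertia_pow_half_smul_sub_not_mem (hp5 : 5 ≤ p) (hG : TypeGOrd W p)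
    (hadd : Addv W p) (h2e : 2 ∣ semistabilityIndex W p) (he : semistabilityIndex W p ≠ 2)
    (hodd : ¬ 2 ∣ (p - 1) / semistabilityIndex W p) (hpv : ((p : ℕ) : 𝓞 ℚ) ∈ v.asIdeal)
    {L : LocalDatum ℚ (W.geomPrimaryTorsion p) v} (hL : IsRamifiedOrdinaryLine W p L) :
    ∃ σ ∈ absInertia (v.adicCompletion ℚ), ∀ m : W.geomPrimaryTorsion p, m ∉ L.plus →
      (absGaloisRestrict ℚ (v.adicCompletion ℚ) σ) ^ ((p - 1) / 2) • m - m ∉ L.plus := by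
  obtain ⟨σ, hσ, hfree⟩ :=
    exists_inertia_forall_pow_smul_sub_not_mem_of_not_dvd hp5 hG hadd he hpv hL
  refine ⟨σ, hσ, hfree _ fun hdiv ↦ hodd ?_⟩
  -- arithmetic: `e ∣ p − 1`, `e = 2e'`, `(p−1)/2 = e' f` with `f = (p−1)/e`; `e ∣ e' f ⇒ 2 ∣ f`
  have hedvd : semistabilityIndex W p ∣ p - 1 :=
    ((typeG_iff_not_subM_and_semistabilityIndex_dvd W p hp5).mp hG.typeG).2
  obtain ⟨f, hf⟩ := hedvd
  obtain ⟨e', he'⟩ := h2e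
  have he0 : 0 < semistabilityIndex W p := Nat.pos_of_ne_zero (semistabilityIndex_ne_zero p W)
  have he'0 : 0 < e' := by
    rcases Nat.eq_zero_or_pos e' with h | h
    · rw [he', h, mul_zero] at he0; exact absurd he0 (lt_irrefl 0)
    · exact h
  have hfe : (p - 1) / semistabilityIndex W p = f := by
    rw [hf, Nat.mul_div_cancel_left f he0]
  have hhalf : (p - 1) / 2 = e' * f := by
    rw [hf, he', mul_assoc, Nat.mul_div_cancel_left _ two_pos]
  rw [hhalf, he'] at hdiv
  obtain ⟨c, hc⟩ := hdiv
  have hf2 : f = 2 * c := by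
    have h1 : e' * f = e' * (2 * c) := by rw [hc]; ring
    exact Nat.eq_of_mul_eq_mul_left he'0 h1
  rw [hfe, hf2]
  exact dvd_mul_right 2 c

end Literature.NumberTheory.EllipticCurves.EmertonPollackWeston2006.IsRamifiedOrdinaryLine

/-! ## §4 Class forms -/

namespace Summit.BirchSwinnertonDyer.Rank1Residual.Additive

open NumberField IsDedekindDomain Field IsDedekindDomain.HeightOneSpectrum WeierstrassCurve
  Literature.NumberTheory.GaloisRepresentations Literature.NumberTheory.EllipticCurves
  Literature.NumberTheory.EllipticCurves.GreenbergSelmer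
  Literature.NumberTheory.EllipticCurves.EmertonPollackWeston2006
  Literature.NumberTheory.EllipticCurves.Rank1Residual

variable {W : WeierstrassCurve ℚ} [W.IsElliptic] [W.IsGloballyMinimal] {p : ℕ} [hp : Fact p.Prime]
  {v : HeightOneSpectrum (𝓞 ℚ)}

/-- **X4♯(G-ord), `p ≥ 5`, `e ≠ 2`: the quotient character of every ramified ordinary line has exact
order `e` with a freely acting generator.** X4♯(G-ord) stays CONSTRUCTION-SHAPED; nothing booked.
[cite: Serre1972, §5.6 (p. 312)] [cite: SerreTate1968, §2 Thm. 2 and Cor. 2] -/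
theorem ClassX4Gord.exists_inertia_forall_pow_smul_sub_not_mem (hX : ClassX4Gord W p) (hp5 : 5 ≤ p)
    (he : semistabilityIndex W p ≠ 2) (hpv : ((p : ℕ) : 𝓞 ℚ) ∈ v.asIdeal)
    {L : LocalDatum ℚ (W.geomPrimaryTorsion p) v} (hL : IsRamifiedOrdinaryLine W p L) :
    ∃ σ ∈ absInertia (v.adicCompletion ℚ), ∀ d : ℕ, 0 < d → d < semistabilityIndex W p →
      ∀ m : W.geomPrimaryTorsion p, m ∉ L.plus →
        (absGaloisRestrict ℚ (v.adicCompletion ℚ) σ) ^ d • m - m ∉ L.plus :=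
  hL.exists_inertia_forall_pow_smul_sub_not_mem hp5 hX.typeGOrd hX.addv.2 he hpv

/-- **X3♯(G-ord), `p ≥ 5`, `e ≠ 2`: the quotient character of every ramified ordinary line has exact
order `e` with a freely acting generator.** X3♯(G-ord) stays CONSTRUCTION-SHAPED; nothing booked.
[cite: Serre1972, §5.6 (p. 312)] [cite: SerreTate1968, §2 Thm. 2 and Cor. 2] -/
theorem ClassX3Gord.exists_inertia_forall_pow_smul_sub_not_mem (hX : ClassX3Gord W p) (hp5 : 5 ≤ p)
    (he : semistabilityIndex W p ≠ 2) (hpv : ((p : ℕ) : 𝓞 ℚ) ∈ v.asIdeal)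
    {L : LocalDatum ℚ (W.geomPrimaryTorsion p) v} (hL : IsRamifiedOrdinaryLine W p L) :
    ∃ σ ∈ absInertia (v.adicCompletion ℚ), ∀ d : ℕ, 0 < d → d < semistabilityIndex W p →
      ∀ m : W.geomPrimaryTorsion p, m ∉ L.plus →
        (absGaloisRestrict ℚ (v.adicCompletion ℚ) σ) ^ d • m - m ∉ L.plus :=
  hL.exists_inertia_forall_pow_smul_sub_not_mem hp5 hX.typeGOrd hX.addv he hpv

/-- **X4♯(G-ord), (5;4)/(7;6)-type rows: NOT quotient-even.** X4♯(G-ord) stays CONSTRUCTION-SHAPED;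
nothing booked. [cite: Serre1972, §5.6 (p. 312)] -/
theorem ClassX4Gord.exists_inertia_pow_half_smul_sub_not_mem (hX : ClassX4Gord W p) (hp5 : 5 ≤ p)
    (h2e : 2 ∣ semistabilityIndex W p) (he : semistabilityIndex W p ≠ 2)
    (hodd : ¬ 2 ∣ (p - 1) / semistabilityIndex W p) (hpv : ((p : ℕ) : 𝓞 ℚ) ∈ v.asIdeal)
    {L : LocalDatum ℚ (W.geomPrimaryTorsion p) v} (hL : IsRamifiedOrdinaryLine W p L) :
    ∃ σ ∈ absInertia (v.adicCompletion ℚ), ∀ m : W.geomPrimaryTorsion p, m ∉ L.plus →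
      (absGaloisRestrict ℚ (v.adicCompletion ℚ) σ) ^ ((p - 1) / 2) • m - m ∉ L.plus :=
  hL.exists_inertia_pow_half_smul_sub_not_mem hp5 hX.typeGOrd hX.addv.2 h2e he hodd hpv

/-- **X3♯(G-ord), (5;4)/(7;6)-type rows: NOT quotient-even.** X3♯(G-ord) stays CONSTRUCTION-SHAPED;
nothing booked. [cite: Serre1972, §5.6 (p. 312)] -/
theorem ClassX3Gord.exists_inertia_pow_half_smul_sub_not_mem (hX : ClassX3Gord W p) (hp5 : 5 ≤ p)
    (h2e : 2 ∣ semistabilityIndex W p) (he : semistabilityIndex W p ≠ 2)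
    (hodd : ¬ 2 ∣ (p - 1) / semistabilityIndex W p) (hpv : ((p : ℕ) : 𝓞 ℚ) ∈ v.asIdeal)
    {L : LocalDatum ℚ (W.geomPrimaryTorsion p) v} (hL : IsRamifiedOrdinaryLine W p L) :
    ∃ σ ∈ absInertia (v.adicCompletion ℚ), ∀ m : W.geomPrimaryTorsion p, m ∉ L.plus →
      (absGaloisRestrict ℚ (v.adicCompletion ℚ) σ) ^ ((p - 1) / 2) • m - m ∉ L.plus :=
  hL.exists_inertia_pow_half_smul_sub_not_mem hp5 hX.typeGOrd hX.addv h2e he hodd hpv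

end Summit.BirchSwinnertonDyer.Rank1Residual.Additive

end
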